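import Summits.Ventures.CertifiedManyBodySolver.Observables.StiffnessThermalLeaf
import Summits.Ventures.CertifiedManyBodySolver.Observables.StiffnessKinematicLeafTTPrime
import Summits.Ventures.CertifiedManyBodySolver.Observables.KTTransitionCeiling
import HarnessLib

/-!
# Ventures/CertifiedManyBodySolver — Observables/StiffnessHalfBathtubBox.lean

HONEST FRAMING: one-sided kinematic (one-body, half-bathtub) CEILINGS on the uniform flux stiffness, ground-state and thermal,
transported from the two `t′`-CORNERS of a filling × `t′` BOX to the whole box; a ceiling never speaks to the presence of order;
not a `T_c` estimate, not a superconductivity verdict; the Kosterlitz–Thouless reading is CONDITIONAL on the named dictionary.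

Cell `hubbard-tc` (MO-S3 ORDER → `T_c` back-end, D-0096), seat p1, `prover-hubbard-tc-p1-g0-0`; the lead's B3 «box row» recipe
(INBOX 2026-08-26T16:36:53Z, structure (i)+(ii)) and the referee's ask (R3: state it over the THERMAL theorem so the box rows are
K3-free), as kernel theorems. A downfolded material arrives with a BOX `t′ ∈ [t′₁, t′₂]`, `n ∈ [0, n₂]` (S1 hulls), while the
half-bathtub hooks `ObsThermalStiffnessSeqCeilingAt_of_halfBathtub_le` / `ObsStiffnessSeqCeilingAt_of_halfBathtub_le` are stated at a
POINT `(t′, n)`: `ν·n/2 + B(t′, ν) ≤ c ⇒` leaf `c`, `B(t′, ν) = (4π²)⁻¹∫_{−π}^{π}∫_{−π}^{π}(cos x + cos y + 4t′cos x cos y − ν)⁺ dx dy`.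
PROVED here (pure real analysis on the explicit integrand; no definition, no named fact, zero computation, no `sorry`):

* `halfBathtubIntegrand_convex` — the integrand is JOINTLY convex in `(t′, ν)`: at `t′ = a t′₁ + b t′₂`, `ν = a ν₁ + b ν₂`
  (`a, b ≥ 0`, `a + b = 1`) the shifted symbol is the same convex combination of the corner symbols, and `(·)⁺` is convex;
* `halfBathtubIntegral_convex` — hence so is the double integral (monotonicity and linearity of the iterated interval integral);
* `halfBathtub_box_le` — **the box transport**: if `ν₁, ν₂ ≥ 0` and the two CORNER values satisfy
  `νᵢ·n₂/2 + B(t′ᵢ, νᵢ) ≤ c` (`i = 1, 2`), then for every `t′ ∈ [t′₁, t′₂]` and every `n ≤ n₂` there is a level `ν ≥ 0`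
  (the same convex combination) with `ν·n/2 + B(t′, ν) ≤ c` — (i) `n ↦ ν·n/2` is non-decreasing for `ν ≥ 0`, (ii) joint convexity.
  Each corner may carry its OWN optimal level `νᵢ`, so the box constant is the larger of the two optimal corner constants, i.e.
  the exact supremum of the convex one-body value `c_kin(n₂, ·)` over `[t′₁, t′₂]` (no sub-intervals needed);
* `ObsThermalStiffnessSeqCeilingAt_box_of_corners_le` — **corner certificates ⇒ the THERMAL leaf `c` on the whole box** (every
  `β > 0`, every `U`; key K1t, no monotonicity) and `ObsStiffnessSeqCeilingAt_box_of_corners_le` (the ground-state leaf);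
* `ThermalKTDictionaryAt.le_pi_div_four_mul_box` — with the monotonicity-free KT dictionary at any anchor of the box,
  `Tc ≤ (π/4)·c` (the cell's B3 / B-x / C-box row grammar «certified-upper·KT (NK jump assumed; thermal kinetic ceiling, no
  monotonicity; 2D single-layer model)»); `KTDictionaryAt.le_pi_div_four_mul_box` for the ground-state dictionary.

The corner inequalities are HYPOTHESES of these theorems (real-number statements about two explicit integrals; the cell certifies
them by outward-rounded interval enclosures, hubbard-tc B3-CERTIFIED.md, referee second engine); a kernel evaluation of `B(t′, ν)` is
not in this file.

References: T. Hazra, N. Verma, M. Randeria, PRX 9 (2019) 031049, eqs. (2)–(6) [HazraVermaRanderia2019]; A. Paramekanti, N. Trivedi,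
M. Randeria, PRB 57 (1998) 11639, eq. (3), §IV [ParamekantiTrivediRanderia1998]; W. Rudin, *Principles of Mathematical Analysis*
(1976), Thm 6.12 (monotonicity/linearity of the integral) [Rudin1976].
-/

noncomputable section

namespace Summit.Ventures.CertifiedManyBodySolver.Observables

open Real MeasureTheory Set Filter Topology
open Literature.MathematicalPhysics.StatisticalMechanics.KosterlitzThouless

/-! ## §1 Joint convexity of the half-bathtub integrand and integral in `(t′, ν)` -/

/-- **The half-bathtub integrand is jointly convex in `(t′, ν)`**: for `a, b ≥ 0`, `a + b = 1`,
`(cos x + cos y + 4(a t₁ + b t₂)cos x cos y − (a ν₁ + b ν₂))⁺ ≤ a·(… t₁ … − ν₁)⁺ + b·(… t₂ … − ν₂)⁺` (the shifted symbol is affine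
in `(t′, ν)` and `u ↦ u⁺` is convex). [cite: Rudin1976, Thm 6.12] -/
theorem halfBathtubIntegrand_convex (t₁ t₂ ν₁ ν₂ a b x y : ℝ) (ha : 0 ≤ a) (hb : 0 ≤ b) (hab : a + b = 1) :
    max (Real.cos x + Real.cos y + 4 * (a * t₁ + b * t₂) * (Real.cos x * Real.cos y) - (a * ν₁ + b * ν₂)) 0 ≤
      a * max (Real.cos x + Real.cos y + 4 * t₁ * (Real.cos x * Real.cos y) - ν₁) 0 +
        b * max (Real.cos x + Real.cos y + 4 * t₂ * (Real.cos x * Real.cos y) - ν₂) 0 := by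
  set u := Real.cos x + Real.cos y + 4 * t₁ * (Real.cos x * Real.cos y) - ν₁ with hu
  set v := Real.cos x + Real.cos y + 4 * t₂ * (Real.cos x * Real.cos y) - ν₂ with hv
  have hconv : Real.cos x + Real.cos y + 4 * (a * t₁ + b * t₂) * (Real.cos x * Real.cos y) - (a * ν₁ + b * ν₂) =
      a * u + b * v := by
    have h1 : Real.cos x + Real.cos y = (a + b) * (Real.cos x + Real.cos y) := by rw [hab, one_mul]
    rw [hu, hv]
    linear_combination h1
  rw [hconv]
  refine max_le ?_ ?_
  · exact add_le_add (mul_le_mul_of_nonneg_left (le_max_left u 0) ha) (mul_le_mul_of_nonneg_left (le_max_left v 0) hb)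
  · exact add_nonneg (mul_nonneg ha (le_max_right u 0)) (mul_nonneg hb (le_max_right v 0))

/-- Continuity of the half-bathtub integrand in the two momenta (for integrability). [cite: Rudin1976, Thm 6.12] -/
theorem continuous_halfBathtubIntegrand (t ν : ℝ) :
    Continuous (Function.uncurry fun y x : ℝ =>
      max (Real.cos x + Real.cos y + 4 * t * (Real.cos x * Real.cos y) - ν) 0) := by
  rw [Function.uncurry_def]
  fun_prop

/-- **The half-bathtub double integral is jointly convex in `(t′, ν)`**: for `a, b ≥ 0`, `a + b = 1`,
`∫∫(… (a t₁ + b t₂) … − (a ν₁ + b ν₂))⁺ ≤ a ∫∫(… t₁ … − ν₁)⁺ + b ∫∫(… t₂ … − ν₂)⁺` (integrate `halfBathtubIntegrand_convex`; monotonicity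
and linearity of the iterated interval integral of continuous functions). [cite: Rudin1976, Thm 6.12] -/
theorem halfBathtubIntegral_convex (t₁ t₂ ν₁ ν₂ a b : ℝ) (ha : 0 ≤ a) (hb : 0 ≤ b) (hab : a + b = 1) :
    (∫ y in (-π)..π, ∫ x in (-π)..π,
        max (Real.cos x + Real.cos y + 4 * (a * t₁ + b * t₂) * (Real.cos x * Real.cos y) - (a * ν₁ + b * ν₂)) 0) ≤
      a * (∫ y in (-π)..π, ∫ x in (-π)..π, max (Real.cos x + Real.cos y + 4 * t₁ * (Real.cos x * Real.cos y) - ν₁) 0) +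
        b * (∫ y in (-π)..π, ∫ x in (-π)..π, max (Real.cos x + Real.cos y + 4 * t₂ * (Real.cos x * Real.cos y) - ν₂) 0) := by
  have hπ : -π ≤ π := by linarith [Real.pi_pos]
  -- the three integrands as functions of `(y, x)`
  set g : ℝ → ℝ → ℝ := fun y x =>
    max (Real.cos x + Real.cos y + 4 * (a * t₁ + b * t₂) * (Real.cos x * Real.cos y) - (a * ν₁ + b * ν₂)) 0 with hgdef
  set g₁ : ℝ → ℝ → ℝ := fun y x => max (Real.cos x + Real.cos y + 4 * t₁ * (Real.cos x * Real.cos y) - ν₁) 0 with hg₁def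
  set g₂ : ℝ → ℝ → ℝ := fun y x => max (Real.cos x + Real.cos y + 4 * t₂ * (Real.cos x * Real.cos y) - ν₂) 0 with hg₂def
  have hg : Continuous (Function.uncurry g) := continuous_halfBathtubIntegrand _ _
  have hg₁ : Continuous (Function.uncurry g₁) := continuous_halfBathtubIntegrand _ _
  have hg₂ : Continuous (Function.uncurry g₂) := continuous_halfBathtubIntegrand _ _
  have hgy : ∀ y, Continuous (g y) := fun y => hg.uncurry_left y
  have hg₁y : ∀ y, Continuous (g₁ y) := fun y => hg₁.uncurry_left y
  have hg₂y : ∀ y, Continuous (g₂ y) := fun y => hg₂.uncurry_left y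
  have hG : Continuous fun y => ∫ x in (-π)..π, g y x :=
    intervalIntegral.continuous_parametric_intervalIntegral_of_continuous' hg (-π) π
  have hG₁ : Continuous fun y => ∫ x in (-π)..π, g₁ y x :=
    intervalIntegral.continuous_parametric_intervalIntegral_of_continuous' hg₁ (-π) π
  have hG₂ : Continuous fun y => ∫ x in (-π)..π, g₂ y x :=
    intervalIntegral.continuous_parametric_intervalIntegral_of_continuous' hg₂ (-π) π
  -- inner integrals
  have hinner : ∀ y, (∫ x in (-π)..π, g y x) ≤ a * (∫ x in (-π)..π, g₁ y x) + b * (∫ x in (-π)..π, g₂ y x) := by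
    intro y
    have hi₁ : IntervalIntegrable (fun x => a * g₁ y x) volume (-π) π :=
      (continuous_const.mul (hg₁y y)).intervalIntegrable _ _
    have hi₂ : IntervalIntegrable (fun x => b * g₂ y x) volume (-π) π :=
      (continuous_const.mul (hg₂y y)).intervalIntegrable _ _
    have hlin : (∫ x in (-π)..π, (a * g₁ y x + b * g₂ y x)) =
        a * (∫ x in (-π)..π, g₁ y x) + b * (∫ x in (-π)..π, g₂ y x) := by
      rw [intervalIntegral.integral_add hi₁ hi₂, intervalIntegral.integral_const_mul,
        intervalIntegral.integral_const_mul]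
    rw [← hlin]
    refine intervalIntegral.integral_mono_on hπ ((hgy y).intervalIntegrable _ _) (hi₁.add hi₂) fun x _ => ?_
    exact halfBathtubIntegrand_convex t₁ t₂ ν₁ ν₂ a b x y ha hb hab
  -- outer integral
  have ho₁ : IntervalIntegrable (fun y => a * (∫ x in (-π)..π, g₁ y x)) volume (-π) π :=
    (continuous_const.mul hG₁).intervalIntegrable _ _
  have ho₂ : IntervalIntegrable (fun y => b * (∫ x in (-π)..π, g₂ y x)) volume (-π) π :=
    (continuous_const.mul hG₂).intervalIntegrable _ _
  have hlin : (∫ y in (-π)..π, (a * (∫ x in (-π)..π, g₁ y x) + b * (∫ x in (-π)..π, g₂ y x))) =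
      a * (∫ y in (-π)..π, ∫ x in (-π)..π, g₁ y x) + b * (∫ y in (-π)..π, ∫ x in (-π)..π, g₂ y x) := by
    rw [intervalIntegral.integral_add ho₁ ho₂, intervalIntegral.integral_const_mul,
      intervalIntegral.integral_const_mul]
  show (∫ y in (-π)..π, ∫ x in (-π)..π, g y x) ≤
    a * (∫ y in (-π)..π, ∫ x in (-π)..π, g₁ y x) + b * (∫ y in (-π)..π, ∫ x in (-π)..π, g₂ y x)
  rw [← hlin]
  exact intervalIntegral.integral_mono_on hπ (hG.intervalIntegrable _ _) (ho₁.add ho₂) fun y _ => hinner y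

/-! ## §2 The box transport of the half-bathtub constant -/

/-- **Box transport of the half-bathtub constant.** Let `ν₁, ν₂ ≥ 0` and suppose the two `t′`-CORNER values at the top filling `n₂`
satisfy `νᵢ·n₂/2 + B(t′ᵢ, νᵢ) ≤ c` (`i = 1, 2`; `B(t′, ν) = (4π²)⁻¹∫∫(cos x + cos y + 4t′cos x cos y − ν)⁺`). Then for every `t′ ∈ [t′₁, t′₂]`
and every `n ≤ n₂` there is a level `ν ≥ 0` with `ν·n/2 + B(t′, ν) ≤ c`: with `t′ = a t′₁ + b t′₂` take `ν = a ν₁ + b ν₂`; (i) `ν·n/2 ≤ ν·n₂/2`,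
(ii) `halfBathtubIntegral_convex`. (Corners with their own optimal levels ⇒ the box constant is the larger optimal corner constant = the
supremum over `[t′₁, t′₂]` of the convex one-body value at `n₂`.) [cite: HazraVermaRanderia2019, eqs. (2)–(6)] -/
theorem halfBathtub_box_le {t₁ t₂ ν₁ ν₂ n₂ c : ℝ} (hν₁ : 0 ≤ ν₁) (hν₂ : 0 ≤ ν₂)
    (h₁ : ν₁ * n₂ / 2 +
      (∫ y in (-π)..π, ∫ x in (-π)..π, max (Real.cos x + Real.cos y + 4 * t₁ * (Real.cos x * Real.cos y) - ν₁) 0) /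
        (4 * π ^ 2) ≤ c)
    (h₂ : ν₂ * n₂ / 2 +
      (∫ y in (-π)..π, ∫ x in (-π)..π, max (Real.cos x + Real.cos y + 4 * t₂ * (Real.cos x * Real.cos y) - ν₂) 0) /
        (4 * π ^ 2) ≤ c)
    {tp n : ℝ} (htp : tp ∈ Icc t₁ t₂) (hn : n ≤ n₂) :
    ∃ ν : ℝ, 0 ≤ ν ∧ ν * n / 2 +
      (∫ y in (-π)..π, ∫ x in (-π)..π, max (Real.cos x + Real.cos y + 4 * tp * (Real.cos x * Real.cos y) - ν) 0) /
        (4 * π ^ 2) ≤ c := by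
  have hπ2 : (0 : ℝ) < 4 * π ^ 2 := by positivity
  rcases eq_or_lt_of_le (htp.1.trans htp.2) with h12 | h12
  · -- degenerate box `t₁ = t₂ = tp`
    have htp1 : tp = t₁ := le_antisymm (h12 ▸ htp.2) htp.1
    subst htp1
    refine ⟨ν₁, hν₁, ?_⟩
    have hmono : ν₁ * n / 2 ≤ ν₁ * n₂ / 2 := by nlinarith
    linarith
  · -- `tp = a t₁ + b t₂`, `a = (t₂ - tp)/(t₂ - t₁)`, `b = (tp - t₁)/(t₂ - t₁)`
    have hd : 0 < t₂ - t₁ := sub_pos.2 h12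
    set a := (t₂ - tp) / (t₂ - t₁) with hadef
    set b := (tp - t₁) / (t₂ - t₁) with hbdef
    have ha : 0 ≤ a := div_nonneg (sub_nonneg.2 htp.2) hd.le
    have hb : 0 ≤ b := div_nonneg (sub_nonneg.2 htp.1) hd.le
    have hab : a + b = 1 := by
      rw [hadef, hbdef, ← add_div, div_eq_one_iff_eq hd.ne']
      ring
    have htpab : tp = a * t₁ + b * t₂ := by
      rw [hadef, hbdef]
      field_simp
      ring
    refine ⟨a * ν₁ + b * ν₂, add_nonneg (mul_nonneg ha hν₁) (mul_nonneg hb hν₂), ?_⟩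
    have hconv := halfBathtubIntegral_convex t₁ t₂ ν₁ ν₂ a b ha hb hab
    rw [← htpab] at hconv
    -- (i) monotonicity in `n`, (ii) convexity
    have hmono : (a * ν₁ + b * ν₂) * n / 2 ≤ (a * ν₁ + b * ν₂) * n₂ / 2 := by
      have hν : 0 ≤ a * ν₁ + b * ν₂ := add_nonneg (mul_nonneg ha hν₁) (mul_nonneg hb hν₂)
      nlinarith
    have hdiv' := div_le_div_of_nonneg_right hconv hπ2.le
    have e : (a * (∫ y in (-π)..π, ∫ x in (-π)..π,
          max (Real.cos x + Real.cos y + 4 * t₁ * (Real.cos x * Real.cos y) - ν₁) 0) +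
        b * (∫ y in (-π)..π, ∫ x in (-π)..π,
          max (Real.cos x + Real.cos y + 4 * t₂ * (Real.cos x * Real.cos y) - ν₂) 0)) / (4 * π ^ 2) =
        a * ((∫ y in (-π)..π, ∫ x in (-π)..π,
          max (Real.cos x + Real.cos y + 4 * t₁ * (Real.cos x * Real.cos y) - ν₁) 0) / (4 * π ^ 2)) +
        b * ((∫ y in (-π)..π, ∫ x in (-π)..π,
          max (Real.cos x + Real.cos y + 4 * t₂ * (Real.cos x * Real.cos y) - ν₂) 0) / (4 * π ^ 2)) := by
      ring
    have hdiv : (∫ y in (-π)..π, ∫ x in (-π)..π,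
        max (Real.cos x + Real.cos y + 4 * tp * (Real.cos x * Real.cos y) - (a * ν₁ + b * ν₂)) 0) / (4 * π ^ 2) ≤
        a * ((∫ y in (-π)..π, ∫ x in (-π)..π,
          max (Real.cos x + Real.cos y + 4 * t₁ * (Real.cos x * Real.cos y) - ν₁) 0) / (4 * π ^ 2)) +
        b * ((∫ y in (-π)..π, ∫ x in (-π)..π,
          max (Real.cos x + Real.cos y + 4 * t₂ * (Real.cos x * Real.cos y) - ν₂) 0) / (4 * π ^ 2)) := by
      rw [← e]
      exact hdiv'
    have hcomb : a * (ν₁ * n₂ / 2 + (∫ y in (-π)..π, ∫ x in (-π)..π,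
          max (Real.cos x + Real.cos y + 4 * t₁ * (Real.cos x * Real.cos y) - ν₁) 0) / (4 * π ^ 2)) +
        b * (ν₂ * n₂ / 2 + (∫ y in (-π)..π, ∫ x in (-π)..π,
          max (Real.cos x + Real.cos y + 4 * t₂ * (Real.cos x * Real.cos y) - ν₂) 0) / (4 * π ^ 2)) ≤ c := by
      calc _ ≤ a * c + b * c := add_le_add (mul_le_mul_of_nonneg_left h₁ ha) (mul_le_mul_of_nonneg_left h₂ hb)
        _ = c := by rw [← add_mul, hab, one_mul]
    linarith [hmono, hdiv, hcomb]

/-! ## §3 Corner certificates ⇒ the leaves on the whole box -/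

/-- **Corner certificates ⇒ the THERMAL stiffness leaf on the whole box** (key K1t, every temperature, no monotonicity): if
`ν₁, ν₂ ≥ 0` and `νᵢ·n₂/2 + B(t′ᵢ, νᵢ) ≤ c` at the two `t′`-corners (`i = 1, 2`, `n₂ ≤ 2`, `c` rational), then
`ObsThermalStiffnessSeqCeilingAt tp U n c` for EVERY `tp ∈ [t′₁, t′₂]`, every `0 ≤ n ≤ n₂` and every `U`.
[cite: ParamekantiTrivediRanderia1998, eq. (3) and §IV] -/
theorem ObsThermalStiffnessSeqCeilingAt_box_of_corners_le {t₁ t₂ ν₁ ν₂ n₂ : ℝ} (hν₁ : 0 ≤ ν₁) (hν₂ : 0 ≤ ν₂)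
    (hn₂ : n₂ ≤ 2) (c : ℚ)
    (h₁ : ν₁ * n₂ / 2 +
      (∫ y in (-π)..π, ∫ x in (-π)..π, max (Real.cos x + Real.cos y + 4 * t₁ * (Real.cos x * Real.cos y) - ν₁) 0) /
        (4 * π ^ 2) ≤ ((c : ℚ) : ℝ))
    (h₂ : ν₂ * n₂ / 2 +
      (∫ y in (-π)..π, ∫ x in (-π)..π, max (Real.cos x + Real.cos y + 4 * t₂ * (Real.cos x * Real.cos y) - ν₂) 0) /
        (4 * π ^ 2) ≤ ((c : ℚ) : ℝ))
    {tp U n : ℝ} (htp : tp ∈ Icc t₁ t₂) (hn0 : 0 ≤ n) (hn : n ≤ n₂) :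
    ObsThermalStiffnessSeqCeilingAt tp U n c := by
  obtain ⟨ν, _, hν⟩ := halfBathtub_box_le hν₁ hν₂ h₁ h₂ htp hn
  exact ObsThermalStiffnessSeqCeilingAt_of_halfBathtub_le tp U n hn0 (hn.trans hn₂) ν c hν

/-- **Corner certificates ⇒ the GROUND-STATE stiffness leaf on the whole box**: the same corners give
`ObsStiffnessSeqCeilingAt tp U n c` for every `tp ∈ [t′₁, t′₂]`, `0 ≤ n ≤ n₂ ≤ 2`, every `U` (`ObsStiffnessSeqCeilingAt_of_halfBathtub_le`).
[cite: HazraVermaRanderia2019, eqs. (2)–(6)] -/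
theorem ObsStiffnessSeqCeilingAt_box_of_corners_le {t₁ t₂ ν₁ ν₂ n₂ : ℝ} (hν₁ : 0 ≤ ν₁) (hν₂ : 0 ≤ ν₂)
    (hn₂ : n₂ ≤ 2) (c : ℚ)
    (h₁ : ν₁ * n₂ / 2 +
      (∫ y in (-π)..π, ∫ x in (-π)..π, max (Real.cos x + Real.cos y + 4 * t₁ * (Real.cos x * Real.cos y) - ν₁) 0) /
        (4 * π ^ 2) ≤ ((c : ℚ) : ℝ))
    (h₂ : ν₂ * n₂ / 2 +
      (∫ y in (-π)..π, ∫ x in (-π)..π, max (Real.cos x + Real.cos y + 4 * t₂ * (Real.cos x * Real.cos y) - ν₂) 0) /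
        (4 * π ^ 2) ≤ ((c : ℚ) : ℝ))
    {tp U n : ℝ} (htp : tp ∈ Icc t₁ t₂) (hn0 : 0 ≤ n) (hn : n ≤ n₂) :
    ObsStiffnessSeqCeilingAt tp U n c := by
  obtain ⟨ν, _, hν⟩ := halfBathtub_box_le hν₁ hν₂ h₁ h₂ htp hn
  exact ObsStiffnessSeqCeilingAt_of_halfBathtub_le tp U n hn0 (hn.trans hn₂) ν c hν

/-! ## §4 The KT reading over a box -/

/-- **B3 / B-x / C-box row grammar, K3-free**: corner certificates (`ν₁, ν₂ ≥ 0`, `νᵢ·n₂/2 + B(t′ᵢ, νᵢ) ≤ c`, `n₂ ≤ 2`) and the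
monotonicity-free KT dictionary `ThermalKTDictionaryAt tp U n ρₑ Tc` at ANY anchor of the box (`tp ∈ [t′₁, t′₂]`, `0 ≤ n ≤ n₂`, any `U`) give
`Tc ≤ (π/4)·c` (tree units, `t = 1`). [cite: HazraVermaRanderia2019, eqs. (2)–(3) and App. G] -/
theorem ThermalKTDictionaryAt.le_pi_div_four_mul_box {t₁ t₂ ν₁ ν₂ n₂ : ℝ} (hν₁ : 0 ≤ ν₁) (hν₂ : 0 ≤ ν₂) (hn₂ : n₂ ≤ 2)
    (c : ℚ)
    (h₁ : ν₁ * n₂ / 2 +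
      (∫ y in (-π)..π, ∫ x in (-π)..π, max (Real.cos x + Real.cos y + 4 * t₁ * (Real.cos x * Real.cos y) - ν₁) 0) /
        (4 * π ^ 2) ≤ ((c : ℚ) : ℝ))
    (h₂ : ν₂ * n₂ / 2 +
      (∫ y in (-π)..π, ∫ x in (-π)..π, max (Real.cos x + Real.cos y + 4 * t₂ * (Real.cos x * Real.cos y) - ν₂) 0) /
        (4 * π ^ 2) ≤ ((c : ℚ) : ℝ))
    {tp U n : ℝ} (htp : tp ∈ Icc t₁ t₂) (hn0 : 0 ≤ n) (hn : n ≤ n₂) {ρe : ℝ → ℝ} {Tc : ℝ}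
    (h : ThermalKTDictionaryAt tp U n ρe Tc) : Tc ≤ π / 4 * ((c : ℚ) : ℝ) :=
  h.le_pi_div_four_mul (ObsThermalStiffnessSeqCeilingAt_box_of_corners_le hν₁ hν₂ hn₂ c h₁ h₂ htp hn0 hn)

/-- The ground-state reading over a box: the same corners and p2's dictionary `KTDictionaryAt tp U n ρₑ Tc` (K2 + K3 + K1b) at any anchor
of the box (`0 ≤ n ≤ n₂`, `n < 2`) give `Tc ≤ (π/4)·c`. [cite: HazraVermaRanderia2019, eqs. (2)–(3)] -/
theorem KTDictionaryAt.le_pi_div_four_mul_box {t₁ t₂ ν₁ ν₂ n₂ : ℝ} (hν₁ : 0 ≤ ν₁) (hν₂ : 0 ≤ ν₂) (hn₂ : n₂ ≤ 2)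
    (c : ℚ)
    (h₁ : ν₁ * n₂ / 2 +
      (∫ y in (-π)..π, ∫ x in (-π)..π, max (Real.cos x + Real.cos y + 4 * t₁ * (Real.cos x * Real.cos y) - ν₁) 0) /
        (4 * π ^ 2) ≤ ((c : ℚ) : ℝ))
    (h₂ : ν₂ * n₂ / 2 +
      (∫ y in (-π)..π, ∫ x in (-π)..π, max (Real.cos x + Real.cos y + 4 * t₂ * (Real.cos x * Real.cos y) - ν₂) 0) /
        (4 * π ^ 2) ≤ ((c : ℚ) : ℝ))
    {tp U n : ℝ} (htp : tp ∈ Icc t₁ t₂) (hn0 : 0 ≤ n) (hn : n ≤ n₂) {ρe : ℝ → ℝ} {Tc : ℝ}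
    (h : KTDictionaryAt tp U n ρe Tc) : Tc ≤ π / 4 * ((c : ℚ) : ℝ) :=
  h.le_pi_div_four_mul (ObsStiffnessSeqCeilingAt_box_of_corners_le hν₁ hν₂ hn₂ c h₁ h₂ htp hn0 hn)

/-! ## §5 The electron-doped mirror: levels `ν ≤ 0`, corners at the BOTTOM filling

For a box on the electron-doped side the optimal levels are non-positive; then `n ↦ ν·n/2` is non-INCREASING and the corner
certificates are taken at the bottom filling `n₁` (cell referee R16 advisory; e.g. NCCO `x = 0.15`, `n ∈ [1.10, 1.20]`). -/

/-- **Box transport, `ν ≤ 0` mirror.** If `ν₁, ν₂ ≤ 0` and the two `t′`-corner values at the BOTTOM filling `n₁` satisfy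
`νᵢ·n₁/2 + B(t′ᵢ, νᵢ) ≤ c`, then for every `t′ ∈ [t′₁, t′₂]` and every `n ≥ n₁` some level `ν ≤ 0` has `ν·n/2 + B(t′, ν) ≤ c`.
[cite: HazraVermaRanderia2019, eqs. (2)–(6)] -/
theorem halfBathtub_box_le_of_nonpos {t₁ t₂ ν₁ ν₂ n₁ c : ℝ} (hν₁ : ν₁ ≤ 0) (hν₂ : ν₂ ≤ 0)
    (h₁ : ν₁ * n₁ / 2 +
      (∫ y in (-π)..π, ∫ x in (-π)..π, max (Real.cos x + Real.cos y + 4 * t₁ * (Real.cos x * Real.cos y) - ν₁) 0) /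
        (4 * π ^ 2) ≤ c)
    (h₂ : ν₂ * n₁ / 2 +
      (∫ y in (-π)..π, ∫ x in (-π)..π, max (Real.cos x + Real.cos y + 4 * t₂ * (Real.cos x * Real.cos y) - ν₂) 0) /
        (4 * π ^ 2) ≤ c)
    {tp n : ℝ} (htp : tp ∈ Icc t₁ t₂) (hn : n₁ ≤ n) :
    ∃ ν : ℝ, ν ≤ 0 ∧ ν * n / 2 +
      (∫ y in (-π)..π, ∫ x in (-π)..π, max (Real.cos x + Real.cos y + 4 * tp * (Real.cos x * Real.cos y) - ν) 0) /
        (4 * π ^ 2) ≤ c := by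
  have hπ2 : (0 : ℝ) < 4 * π ^ 2 := by positivity
  rcases eq_or_lt_of_le (htp.1.trans htp.2) with h12 | h12
  · have htp1 : tp = t₁ := le_antisymm (h12 ▸ htp.2) htp.1
    subst htp1
    refine ⟨ν₁, hν₁, ?_⟩
    have hmono : ν₁ * n / 2 ≤ ν₁ * n₁ / 2 := by nlinarith
    linarith
  · have hd : 0 < t₂ - t₁ := sub_pos.2 h12
    set a := (t₂ - tp) / (t₂ - t₁) with hadef
    set b := (tp - t₁) / (t₂ - t₁) with hbdef
    have ha : 0 ≤ a := div_nonneg (sub_nonneg.2 htp.2) hd.le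
    have hb : 0 ≤ b := div_nonneg (sub_nonneg.2 htp.1) hd.le
    have hab : a + b = 1 := by
      rw [hadef, hbdef, ← add_div, div_eq_one_iff_eq hd.ne']
      ring
    have htpab : tp = a * t₁ + b * t₂ := by
      rw [hadef, hbdef]
      field_simp
      ring
    have hν : a * ν₁ + b * ν₂ ≤ 0 := by nlinarith [mul_nonneg ha (neg_nonneg.2 hν₁), mul_nonneg hb (neg_nonneg.2 hν₂)]
    refine ⟨a * ν₁ + b * ν₂, hν, ?_⟩
    have hconv := halfBathtubIntegral_convex t₁ t₂ ν₁ ν₂ a b ha hb hab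
    rw [← htpab] at hconv
    have hmono : (a * ν₁ + b * ν₂) * n / 2 ≤ (a * ν₁ + b * ν₂) * n₁ / 2 := by nlinarith
    have hdiv' := div_le_div_of_nonneg_right hconv hπ2.le
    have e : (a * (∫ y in (-π)..π, ∫ x in (-π)..π,
          max (Real.cos x + Real.cos y + 4 * t₁ * (Real.cos x * Real.cos y) - ν₁) 0) +
        b * (∫ y in (-π)..π, ∫ x in (-π)..π,
          max (Real.cos x + Real.cos y + 4 * t₂ * (Real.cos x * Real.cos y) - ν₂) 0)) / (4 * π ^ 2) =
        a * ((∫ y in (-π)..π, ∫ x in (-π)..π,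
          max (Real.cos x + Real.cos y + 4 * t₁ * (Real.cos x * Real.cos y) - ν₁) 0) / (4 * π ^ 2)) +
        b * ((∫ y in (-π)..π, ∫ x in (-π)..π,
          max (Real.cos x + Real.cos y + 4 * t₂ * (Real.cos x * Real.cos y) - ν₂) 0) / (4 * π ^ 2)) := by
      ring
    have hdiv : (∫ y in (-π)..π, ∫ x in (-π)..π,
        max (Real.cos x + Real.cos y + 4 * tp * (Real.cos x * Real.cos y) - (a * ν₁ + b * ν₂)) 0) / (4 * π ^ 2) ≤
        a * ((∫ y in (-π)..π, ∫ x in (-π)..π,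
          max (Real.cos x + Real.cos y + 4 * t₁ * (Real.cos x * Real.cos y) - ν₁) 0) / (4 * π ^ 2)) +
        b * ((∫ y in (-π)..π, ∫ x in (-π)..π,
          max (Real.cos x + Real.cos y + 4 * t₂ * (Real.cos x * Real.cos y) - ν₂) 0) / (4 * π ^ 2)) := by
      rw [← e]
      exact hdiv'
    have hcomb : a * (ν₁ * n₁ / 2 + (∫ y in (-π)..π, ∫ x in (-π)..π,
          max (Real.cos x + Real.cos y + 4 * t₁ * (Real.cos x * Real.cos y) - ν₁) 0) / (4 * π ^ 2)) +
        b * (ν₂ * n₁ / 2 + (∫ y in (-π)..π, ∫ x in (-π)..π,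
          max (Real.cos x + Real.cos y + 4 * t₂ * (Real.cos x * Real.cos y) - ν₂) 0) / (4 * π ^ 2)) ≤ c := by
      calc _ ≤ a * c + b * c := add_le_add (mul_le_mul_of_nonneg_left h₁ ha) (mul_le_mul_of_nonneg_left h₂ hb)
        _ = c := by rw [← add_mul, hab, one_mul]
    linarith [hmono, hdiv, hcomb]

/-- **Corner certificates at the bottom filling ⇒ the THERMAL leaf on an electron-doped box**: `ν₁, ν₂ ≤ 0`,
`νᵢ·n₁/2 + B(t′ᵢ, νᵢ) ≤ c` (`0 ≤ n₁`), then `ObsThermalStiffnessSeqCeilingAt tp U n c` for every `tp ∈ [t′₁, t′₂]`, `n₁ ≤ n ≤ 2`, every `U`.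
[cite: ParamekantiTrivediRanderia1998, eq. (3) and §IV] -/
theorem ObsThermalStiffnessSeqCeilingAt_box_of_corners_le_of_nonpos {t₁ t₂ ν₁ ν₂ n₁ : ℝ} (hν₁ : ν₁ ≤ 0) (hν₂ : ν₂ ≤ 0)
    (hn₁ : 0 ≤ n₁) (c : ℚ)
    (h₁ : ν₁ * n₁ / 2 +
      (∫ y in (-π)..π, ∫ x in (-π)..π, max (Real.cos x + Real.cos y + 4 * t₁ * (Real.cos x * Real.cos y) - ν₁) 0) /
        (4 * π ^ 2) ≤ ((c : ℚ) : ℝ))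
    (h₂ : ν₂ * n₁ / 2 +
      (∫ y in (-π)..π, ∫ x in (-π)..π, max (Real.cos x + Real.cos y + 4 * t₂ * (Real.cos x * Real.cos y) - ν₂) 0) /
        (4 * π ^ 2) ≤ ((c : ℚ) : ℝ))
    {tp U n : ℝ} (htp : tp ∈ Icc t₁ t₂) (hn : n₁ ≤ n) (hn2 : n ≤ 2) :
    ObsThermalStiffnessSeqCeilingAt tp U n c := by
  obtain ⟨ν, _, hν⟩ := halfBathtub_box_le_of_nonpos hν₁ hν₂ h₁ h₂ htp hn
  exact ObsThermalStiffnessSeqCeilingAt_of_halfBathtub_le tp U n (hn₁.trans hn) hn2 ν c hν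

/-- The ground-state leaf on an electron-doped box from bottom-filling corners (`ν₁, ν₂ ≤ 0`).
[cite: HazraVermaRanderia2019, eqs. (2)–(6)] -/
theorem ObsStiffnessSeqCeilingAt_box_of_corners_le_of_nonpos {t₁ t₂ ν₁ ν₂ n₁ : ℝ} (hν₁ : ν₁ ≤ 0) (hν₂ : ν₂ ≤ 0)
    (hn₁ : 0 ≤ n₁) (c : ℚ)
    (h₁ : ν₁ * n₁ / 2 +
      (∫ y in (-π)..π, ∫ x in (-π)..π, max (Real.cos x + Real.cos y + 4 * t₁ * (Real.cos x * Real.cos y) - ν₁) 0) /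
        (4 * π ^ 2) ≤ ((c : ℚ) : ℝ))
    (h₂ : ν₂ * n₁ / 2 +
      (∫ y in (-π)..π, ∫ x in (-π)..π, max (Real.cos x + Real.cos y + 4 * t₂ * (Real.cos x * Real.cos y) - ν₂) 0) /
        (4 * π ^ 2) ≤ ((c : ℚ) : ℝ))
    {tp U n : ℝ} (htp : tp ∈ Icc t₁ t₂) (hn : n₁ ≤ n) (hn2 : n ≤ 2) :
    ObsStiffnessSeqCeilingAt tp U n c := by
  obtain ⟨ν, _, hν⟩ := halfBathtub_box_le_of_nonpos hν₁ hν₂ h₁ h₂ htp hn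
  exact ObsStiffnessSeqCeilingAt_of_halfBathtub_le tp U n (hn₁.trans hn) hn2 ν c hν

/-- **Electron-doped box row grammar, K3-free**: bottom-filling corner certificates (`νᵢ ≤ 0`) and the monotonicity-free KT
dictionary at any anchor of the box (`tp ∈ [t′₁, t′₂]`, `n₁ ≤ n ≤ 2`) give `Tc ≤ (π/4)·c`. [cite: HazraVermaRanderia2019, eqs. (2)–(3) and App. G] -/
theorem ThermalKTDictionaryAt.le_pi_div_four_mul_box_of_nonpos {t₁ t₂ ν₁ ν₂ n₁ : ℝ} (hν₁ : ν₁ ≤ 0) (hν₂ : ν₂ ≤ 0)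
    (hn₁ : 0 ≤ n₁) (c : ℚ)
    (h₁ : ν₁ * n₁ / 2 +
      (∫ y in (-π)..π, ∫ x in (-π)..π, max (Real.cos x + Real.cos y + 4 * t₁ * (Real.cos x * Real.cos y) - ν₁) 0) /
        (4 * π ^ 2) ≤ ((c : ℚ) : ℝ))
    (h₂ : ν₂ * n₁ / 2 +
      (∫ y in (-π)..π, ∫ x in (-π)..π, max (Real.cos x + Real.cos y + 4 * t₂ * (Real.cos x * Real.cos y) - ν₂) 0) /
        (4 * π ^ 2) ≤ ((c : ℚ) : ℝ))
    {tp U n : ℝ} (htp : tp ∈ Icc t₁ t₂) (hn : n₁ ≤ n) (hn2 : n ≤ 2) {ρe : ℝ → ℝ} {Tc : ℝ}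
    (h : ThermalKTDictionaryAt tp U n ρe Tc) : Tc ≤ π / 4 * ((c : ℚ) : ℝ) :=
  h.le_pi_div_four_mul (ObsThermalStiffnessSeqCeilingAt_box_of_corners_le_of_nonpos hν₁ hν₂ hn₁ c h₁ h₂ htp hn hn2)

end Summit.Ventures.CertifiedManyBodySolver.Observables

end
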